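import Summits.BirchSwinnertonDyer.BirchSwinnertonDyer.Theorems.ThetaPartnerAtTwoSignedTransportAtTwoFormalRetraction
import Summits.BirchSwinnertonDyer.BirchSwinnertonDyer.Theorems.ThetaPartnerAtTwoSignedTransportAtTwoSaturationTwo
import Summits.BirchSwinnertonDyer.BirchSwinnertonDyer.Theorems.ThetaPartnerAtTwoSignedTransportAtTwoResidualRigidity
import Summits.BirchSwinnertonDyer.BirchSwinnertonDyer.Theorems.ThetaPartnerAtTwoSignedTransportAtTwoResidualKummer
import Summits.BirchSwinnertonDyer.BirchSwinnertonDyer.Theorems.ThetaPartnerAtTwoSignedTransportAtTwoHondaTransport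
import Summits.BirchSwinnertonDyer.Rank1Residual.Additive.KobayashiSignedGenerationDischarge
import Summits.BirchSwinnertonDyer.Rank1Residual.Additive.KobayashiSignedGenerationTower
import Summits.BirchSwinnertonDyer.Rank1Residual.Additive.RamifiedOrdinaryLineTorsionFixed
import HarnessLib

/-!
# The local transport at `2` over `ℚ̄₂`: a `Gal(ℚ̄₂/ℚ₂)`-equivariant homomorphism `W(ℚ̄₂) → A(ℚ̄₂)` restricting to the given
# `W[2] ≃ A[2]` — for the crux `SignedTransportAtTwo` (stmt-BirchSwinnertonDyer-20333, route `ThetaPartnerAtTwo`, line `bridge`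
# v16, stub `stub_sel2Tb`, assembly over Mathlib's `ℚ_[2]`) (lead prover bsd-wall-tp2-p1 g5;
# `--supports stmt-BirchSwinnertonDyer-20333`; route-independent, closes nothing)

HONEST FRAMING. THEOREMS ONLY (no definition); nothing about any Selmer group is asserted; BSD is not proved by any of this.
No import of any route file.

WHAT. For `W, A / ℚ` globally minimal, good supersingular at `2` with `a₂(W) = a₂(A) = 0`, an embedding `ι : ℚ̄ → ℚ̄₂` and
a `Γ_ℚ`-equivariant `ẽ : W[2^∞][2] ≃ A[2^∞][2]`: **`exists_equivariant_hom_padic`** — there is an additive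
`Ψ : W(ℚ̄₂) → A(ℚ̄₂)` (the tree's `localPoints · ℚ_[2]`), `Gal(ℚ̄₂/ℚ₂)`-equivariant, with `Ψ(ι x) = ι(ẽ x)` on `W[2^∞][2]`.
Assembly of the program T1–T5: `Ψ = Φ ∘ r` with `r : W(ℚ̄₂) → Ŵ(𝔪̄)` the equivariant retraction (`…FormalRetraction`, fed
by the odd saturation `…SaturationTwo`) and `Φ : Ŵ(𝔪̄) → Â(𝔪̄)` the Honda map (`…HondaOmega`, with p544432's `ψ`); `Ψ` is
injective on `W[2] ⊆ Ŵ(𝔪̄)`, so `Ψ ∘ ι` and `ι ∘ ẽ` are two injective equivariant maps `W[2] → A(ℚ̄₂)` and coincide by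
residual rigidity (`…ResidualRigidity.eq_of_injective_of_equivariant`).

References: [Kobayashi2003] §8.4; [BDKim2009] Prop. 2.11–2.12 (p. 186); [Serre1972] §5.3; [SilvermanAEC2009] VII.2.
-/

set_option autoImplicit false
-- D-0017: single-problem summit, so `Summit.BirchSwinnertonDyer.BirchSwinnertonDyer.…` repeats a namespace BY DESIGN.
set_option linter.dupNamespace false

noncomputable section

open scoped Classical NNReal AddSubgroup

open PowerSeries WeierstrassCurve Literature.RingTheory.FormalGroups Literature.NumberTheory.EllipticCurves
  Literature.NumberTheory.EllipticCurves.FormalGroupChart Literature.NumberTheory.GaloisRepresentations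
  Literature.NumberTheory.EllipticCurves.Rank1Residual
  Summit.BirchSwinnertonDyer.Rank1Residual.Additive Summit.BirchSwinnertonDyer.Rank1Residual.Additive.BallEval
  Literature.NumberTheory.GaloisRepresentations.LubinTate Field

namespace Summit.BirchSwinnertonDyer.BirchSwinnertonDyer.Theorems.SignedTransportAtTwo

/-! ## §1 The `ℤ₂`-model in the binders of the Honda/Kobayashi files -/

/-- **The `ℤ_p`-model of a globally minimal `V/ℚ` with good reduction at `p` and `a_p(V) = 0`**: `M = integralModelInt V ⊗ ℤ_p`
has elliptic generic and special fibres, `tr(M mod p) = 0`, `M ⊗ ℚ_p = V ⊗ ℚ_p` and `M ⊗ ℚ̄_p = V ⊗ ℚ̄_p` (the tree's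
`exists_padicModel_tr_eq_zero`, with the `ℚ_p`-level equation added). [cite: SilvermanAEC2009, VII.5 Prop. 5.1(a)] -/
theorem exists_padicModel {p : ℕ} [Fact p.Prime] (V : WeierstrassCurve ℚ) [V.IsElliptic] [V.IsGloballyMinimal]
    (hgood : V.HasGoodReductionAtPrime p) (hap : V.frobeniusTrace p = 0) :
    ∃ M : WeierstrassCurve ℤ_[p], (M.map PadicInt.Coe.ringHom).IsElliptic ∧ (M.map PadicInt.toZMod).IsElliptic ∧
      Literature.NumberTheory.EllipticCurves.HasseManin.tr (M.map PadicInt.toZMod) = 0 ∧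
      M.map PadicInt.Coe.ringHom = V.map (algebraMap ℚ ℚ_[p]) ∧
      M.baseChange (AlgebraicClosure ℚ_[p]) = V.baseChange (AlgebraicClosure ℚ_[p]) := by
  obtain ⟨M, hE, hEt, htr, hΩ⟩ := exists_padicModel_tr_eq_zero V hgood hap
  refine ⟨M, hE, hEt, htr, ?_, hΩ⟩
  -- `M ⊗ ℚ_p = V ⊗ ℚ_p`: both base-change to `V ⊗ ℚ̄_p`, and `ℚ_p → ℚ̄_p` is injective
  have h1 : (M.map (PadicInt.Coe.ringHom (p := p))).map (algebraMap ℚ_[p] (AlgebraicClosure ℚ_[p])) =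
      (V.map (algebraMap ℚ ℚ_[p])).map (algebraMap ℚ_[p] (AlgebraicClosure ℚ_[p])) := by
    rw [WeierstrassCurve.map_map, WeierstrassCurve.map_map, ← IsScalarTower.algebraMap_eq,
      ← Literature.NumberTheory.EllipticCurves.algebraMap_padicInt_eq, ← IsScalarTower.algebraMap_eq]
    exact hΩ
  exact WeierstrassCurve.map_injective (algebraMap ℚ_[p] (AlgebraicClosure ℚ_[p])).injective h1

/-! ## §2 The Galois action read on the `ℤ_p`-model -/

section Act

variable {p : ℕ} [hp : Fact p.Prime] (W : WeierstrassCurve ℚ) {M : WeierstrassCurve ℤ_[p]}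

/-- **`toLoc` intertwines the coordinatewise action `Point.map τ` on `(M ⊗ Ω)(Ω)` with the `Γ_{ℚ_p}`-action on the local
points `E(K̄_{ℚ_p})`** (the tree's `act_some`). [cite: SilvermanAEC2009, VIII.§1] -/
theorem toLoc_symm_smul (hV : genFibΩ p M = W.baseChange (AlgebraicClosure ℚ_[p])) (τ : absoluteGaloisGroup ℚ_[p])
    (Q : (genFibΩ p M).toAffine.Point) :
    (toLoc hV).symm (τ • toLoc hV Q) =
      Affine.Point.map ((absoluteGaloisGroup.toAlgEquiv ℚ_[p] τ : PadicAlgCl p ≃ₐ[ℚ_[p]] PadicAlgCl p) :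
        PadicAlgCl p →ₐ[ℚ_[p]] PadicAlgCl p) Q := by
  rcases Q with _ | ⟨x, y, h⟩
  · change (toLoc hV).symm (τ • toLoc hV 0) = Affine.Point.map _ 0
    rw [map_zero, smul_zero, map_zero, map_zero]
  · obtain ⟨h', e⟩ := act_some hV τ x y h
    rw [e, Affine.Point.map_some]
    rfl

/-- The same, solved for the local action: `τ • toLoc Q = toLoc (τ Q)`. [folklore] -/
theorem smul_toLoc (hV : genFibΩ p M = W.baseChange (AlgebraicClosure ℚ_[p])) (τ : absoluteGaloisGroup ℚ_[p])
    (Q : (genFibΩ p M).toAffine.Point) :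
    τ • toLoc hV Q =
      toLoc hV (Affine.Point.map ((absoluteGaloisGroup.toAlgEquiv ℚ_[p] τ : PadicAlgCl p ≃ₐ[ℚ_[p]] PadicAlgCl p) :
        PadicAlgCl p →ₐ[ℚ_[p]] PadicAlgCl p) Q) := by
  rw [← toLoc_symm_smul W hV τ Q, AddEquiv.apply_symm_apply]

end Act

/-! ## §3 The transport `Ψ = Φ ∘ r` over `ℚ̄₂` -/

section Padic

variable (W A : WeierstrassCurve ℚ) [W.IsElliptic] [W.IsGloballyMinimal] [A.IsElliptic] [A.IsGloballyMinimal]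

/-- **The local transport at `2` over Mathlib's `ℚ̄₂`.** For `W, A / ℚ` globally minimal, good supersingular at `2` with
`a₂(W) = a₂(A) = 0`, an embedding `ι : ℚ̄ → ℚ̄₂` and a `Γ_ℚ`-equivariant `ẽ : W[2^∞][2] ≃ A[2^∞][2]`, there is an additive
`Gal(ℚ̄₂/ℚ₂)`-equivariant `Ψ : W(ℚ̄₂) → A(ℚ̄₂)` with `Ψ (ι x) = ι (ẽ x)` on `W[2^∞][2]`: `Ψ = Φ ∘ r` (Honda map after the
retraction onto the formal group), and `Ψ ∘ ι = ι ∘ ẽ` by residual rigidity. [cite: Kobayashi2003, §8.4]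
[cite: BDKim2009, Prop. 2.11–2.12 (p. 186)] [cite: Serre1972, §5.3] -/
theorem exists_equivariant_hom_padic (hssW : GoodSS W 2) (ha2W : W.frobeniusTrace 2 = 0) (hssA : GoodSS A 2)
    (ha2A : A.frobeniusTrace 2 = 0) (ι : AlgebraicClosure ℚ →ₐ[ℚ] AlgebraicClosure ℚ_[2])
    (e' : ↥((↥(W.geomPrimaryTorsion 2))[(2 : ℤ)]) ≃+ ↥((↥(A.geomPrimaryTorsion 2))[(2 : ℤ)]))
    (he' : ∀ (σ : absoluteGaloisGroup ℚ) (x : ↥((↥(W.geomPrimaryTorsion 2))[(2 : ℤ)])), e' (σ • x) = σ • e' x) :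
    ∃ Ψ : localPoints W ℚ_[2] →+ localPoints A ℚ_[2],
      (∀ (τ : absoluteGaloisGroup ℚ_[2]) (P : localPoints W ℚ_[2]), Ψ (τ • P) = τ • Ψ P) ∧
      (∀ x : ↥((↥(W.geomPrimaryTorsion 2))[(2 : ℤ)]),
        Ψ (pointsMapOfEmb W ι ((x : W.geomPrimaryTorsion 2) : W.geomPoints)) =
          pointsMapOfEmb A ι ((e' x : A.geomPrimaryTorsion 2) : A.geomPoints)) := by
  -- models
  obtain ⟨MW, hEW, hEtW, htrW, hMW, hΩW⟩ := exists_padicModel W hssW.1 ha2W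
  obtain ⟨MA, hEA, hEtA, htrA, hMA, hΩA⟩ := exists_padicModel A hssA.1 ha2A
  haveI := hEW; haveI := hEtW; haveI := hEA; haveI := hEtA
  haveI hintW := isIntegral_genFib_baseChange 2 MW
  haveI hintA := isIntegral_genFib_baseChange 2 MA
  have hVW : genFibΩ 2 MW = W.baseChange (AlgebraicClosure ℚ_[2]) := (genFibΩ_eq_baseChange MW).trans hΩW
  have hVA : genFibΩ 2 MA = A.baseChange (AlgebraicClosure ℚ_[2]) := (genFibΩ_eq_baseChange MA).trans hΩA
  -- Honda series
  obtain ⟨ψ, hψ0, hψ, hlog⟩ := exists_padicInt_formalLog_subst_eq_formalLog_two_of_goodSS W A hssW ha2W hssA ha2A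
  rw [← hMW, ← hMA] at hlog
  -- the Honda map and the retraction
  obtain ⟨Φ, hΦk, -, hΦinj, hΦσ⟩ := exists_hondaMapΩ MW MA hψ0 hψ hlog
  obtain ⟨r, hrid, -, hrσ⟩ := exists_retraction (p := 2) MW (fun P ↦ exists_odd_nsmul_mem_kernel MW htrW P)
  -- the composite on local points
  set eW := toLoc (W := W) hVW with heW
  set eA := toLoc (W := A) hVA with heA
  let Ψ : localPoints W ℚ_[2] →+ localPoints A ℚ_[2] :=
    eA.toAddMonoidHom.comp ((Φ.comp r).comp eW.symm.toAddMonoidHom)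
  have hΨ : ∀ P, Ψ P = eA (Φ (r (eW.symm P))) := fun P ↦ rfl
  -- equivariance
  have hΨσ : ∀ (τ : absoluteGaloisGroup ℚ_[2]) (P : localPoints W ℚ_[2]), Ψ (τ • P) = τ • Ψ P := by
    intro τ P
    set τ' : PadicAlgCl 2 ≃ₐ[ℚ_[2]] PadicAlgCl 2 := absoluteGaloisGroup.toAlgEquiv ℚ_[2] τ with hτ'
    obtain ⟨Q, rfl⟩ : ∃ Q, P = eW Q := ⟨eW.symm P, (eW.apply_symm_apply P).symm⟩
    rw [hΨ, hΨ, smul_toLoc W hVW τ Q, heW, AddEquiv.symm_apply_apply, AddEquiv.symm_apply_apply, heA,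
      smul_toLoc A hVA τ]
    congr 1
    have h1 : r (Affine.Point.map (τ' : PadicAlgCl 2 →ₐ[ℚ_[2]] PadicAlgCl 2) Q) =
        ⟨Affine.Point.map (τ' : PadicAlgCl 2 →ₐ[ℚ_[2]] PadicAlgCl 2) (r Q : (genFibΩ 2 MW).toAffine.Point),
          (pointMap_mem_kernel_iff MW τ' _).mpr (r Q).2⟩ := Subtype.ext (hrσ τ' Q)
    rw [h1, hΦσ τ' (r Q)]
  refine ⟨Ψ, hΨσ, ?_⟩
  -- agreement with `ẽ` on `W[2^∞][2]` by residual rigidity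
  set X := ↥((↥(W.geomPrimaryTorsion 2))[(2 : ℤ)]) with hX
  have hXcard : Nat.card X = 4 := by
    have h := natCard_torsionBy_geomPrimaryTorsion (W := W) (p := 2)
    exact h
  have hX2 : ∀ x : X, (2 : ℕ) • x = 0 := fun x ↦ AddSubgroup.torsionBy.nsmul x
  -- the two maps `X → A(ℚ̄₂)`
  let jW : X →+ localPoints W ℚ_[2] :=
    (pointsMapOfEmb W ι).comp ((W.geomPrimaryTorsion 2).subtype.comp ((↥(W.geomPrimaryTorsion 2))[(2 : ℤ)]).subtype)
  let jA : ↥((↥(A.geomPrimaryTorsion 2))[(2 : ℤ)]) →+ localPoints A ℚ_[2] :=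
    (pointsMapOfEmb A ι).comp ((A.geomPrimaryTorsion 2).subtype.comp ((↥(A.geomPrimaryTorsion 2))[(2 : ℤ)]).subtype)
  have hjW : ∀ x : X, jW x = pointsMapOfEmb W ι ((x : W.geomPrimaryTorsion 2) : W.geomPoints) := fun x ↦ rfl
  have hjA : ∀ y, jA y = pointsMapOfEmb A ι ((y : A.geomPrimaryTorsion 2) : A.geomPoints) := fun y ↦ rfl
  let f : X →+ localPoints A ℚ_[2] := Ψ.comp jW
  let g : X →+ localPoints A ℚ_[2] := jA.comp e'.toAddMonoidHom
  have hf : ∀ x, f x = Ψ (jW x) := fun x ↦ rfl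
  have hg : ∀ x, g x = jA (e' x) := fun x ↦ rfl
  -- `jW x` is `2`-torsion, hence in the formal group
  have hjW2 : ∀ x : X, (2 : ℕ) • jW x = 0 := fun x ↦ by rw [← map_nsmul, hX2, map_zero]
  have hjWker : ∀ x : X, eW.symm (jW x) ∈ kernel (Valued.v (R := PadicAlgCl 2)) (genFibΩ 2 MW) := fun x ↦
    mem_kernel_of_two_pow_nsmul_eq_zero MW htrW (n := 1) (by rw [pow_one, ← map_nsmul, hjW2, map_zero])
  have hfinj : Function.Injective f := by
    rw [injective_iff_map_eq_zero]
    intro x hx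
    rw [hf, hΨ] at hx
    have h1 : Φ (r (eW.symm (jW x))) = 0 := eA.injective (by rw [hx, map_zero])
    have h2 : r (eW.symm (jW x)) = 0 := hΦinj (by rw [h1, map_zero])
    rw [hrid _ (hjWker x)] at h2
    have h3 : eW.symm (jW x) = 0 := congrArg Subtype.val h2
    have h4 : jW x = 0 := eW.symm.injective (by rw [h3, map_zero])
    rw [hjW] at h4
    have h5 := pointsMapOfEmb_injective W ι (by rw [h4, map_zero] : pointsMapOfEmb W ι _ = pointsMapOfEmb W ι 0)
    exact Subtype.ext (Subtype.ext h5)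
  have hginj : Function.Injective g := by
    intro x y hxy
    rw [hg, hg, hjA, hjA] at hxy
    have h1 := pointsMapOfEmb_injective A ι hxy
    exact e'.injective (Subtype.ext (Subtype.ext h1))
  have hτ : ∀ σ : absoluteGaloisGroup ℚ_[2], ∃ τ : X → X, ∀ x, f (τ x) = σ • f x ∧ g (τ x) = σ • g x := by
    intro σ
    refine ⟨fun x ↦ resGalOfEmb ι σ • x, fun x ↦ ⟨?_, ?_⟩⟩
    · rw [hf, hf, hjW, hjW, ← hΨσ, ← pointsMapOfEmb_smul]
      rfl
    · rw [hg, hg, hjA, hjA, he', ← pointsMapOfEmb_smul]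
      rfl
  have hfg := eq_of_injective_of_equivariant A hssA hXcard hX2 f g hfinj hginj hτ
  intro x
  have := congrArg (fun φ : X →+ localPoints A ℚ_[2] ↦ φ x) hfg
  simpa only [hf, hg, hjW, hjA] using this

end Padic

end Summit.BirchSwinnertonDyer.BirchSwinnertonDyer.Theorems.SignedTransportAtTwo

end
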